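import Mathlib
import HarnessLib
import Summits.ResolutionOfSingularities.ResolutionOfSingularities.Theorems.WildQuotientsWildQuotientResolutionS1aCuspResidualOChart
import Summits.ResolutionOfSingularities.ResolutionOfSingularities.Theorems.WildQuotientsWildQuotientResolutionS1aResidualPointTransport

/-!
# S1a — R4c cusp COVER obligation (C1) at `O`, SCHEME FORM: the residual points of the producer chart `O′₀₁ = [N(x₁)]` lie in the member open `U_O = D(b_O)`

[OURS · L1 W4.5c · leafhand-res-wildquotients-7 g1] — NOT statements of the manuscript; counted 0; AI-level work, weaker than expert review. Crux
stmt-ResolutionOfSingularities-17941 `CyclicQuotientFourfolds`, line `s1a-logminvertex` v13 (`stub_reachLowerInFX`), R4c `cusp_killsIn_two` (crux-dir skeleton v2,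
`Lines/s1a_logminvertex-R4c-PROGRESS-v2.md` COVER obligation 1 at `O`; hand-7 g0 repair census item (a)/(C1) at `O`).

★ `cuspO_mem_basicOpen_of_residual` — in the setting of ✓`exists_cuspO_memberChart_rel_xi` (producer chart `W` of the level-1 root over `W_O` with cover
element `N(x₁)^{n₁}`, pinned chart iso `E : Γ(V, W) ≃ (R_c)₀`), let `b ∈ Γ(V, W)` have the chart value exported by that lemma
(`E b = ((N_R(u₂′)·N_R(ĥ))^{dbar})/1 · (1/c)^{3p+3p}`). Then every point `v ∈ W` at which BOTH residual sections `u₀′^{n₀}/c`, `t̂ⁿ/c` vanish lies in `D(b)`: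
the residual set `R₀₁` of the COVER obligation is inside the member open `U_O`. Assembly of ✓`KillCert.QhSym.cuspO_bHat_not_mem_of_residualSections` (ring side,
p820215) and ✓`BlowupCharts.mem_basicOpen_of_forall_isPrime` (point ↦ prime of `R_c`, degree-0 lying over) with the free model ✓`FreeModel.exists_chartFreeModelEquiv`;
`q ≠ 0` comes for free from the existence of a prime of `R_c`.
-/

set_option linter.dupNamespace false

noncomputable section

open CategoryTheory AlgebraicGeometry TopologicalSpace Opposite MvPolynomial
open Literature.AlgebraicGeometry.Resolution
open scoped LaurentPolynomial
open Summit.ResolutionOfSingularities.ResolutionOfSingularities.Theorems.WildQuotientResolution.S1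
open Summit.ResolutionOfSingularities.ResolutionOfSingularities.Theorems.WildQuotientResolution.S1.CoarseChart
open Summit.ResolutionOfSingularities.ResolutionOfSingularities.Theorems.WildQuotientResolution.S1.ProducerStep
open Summit.ResolutionOfSingularities.ResolutionOfSingularities.Theorems.WildQuotientResolution.S1.ReesBigrading
open Summit.ResolutionOfSingularities.ResolutionOfSingularities.Theorems.WildQuotientResolution.S1.NodeTransport
open Summit.ResolutionOfSingularities.ResolutionOfSingularities.Theorems.WildQuotientResolution.S1.CobordantTransport
open Summit.ResolutionOfSingularities.ResolutionOfSingularities.Theorems.WildQuotientResolution.S1.NodeAway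
open Summit.ResolutionOfSingularities.ResolutionOfSingularities.Theorems.WildQuotientResolution.S1.CentreAway
open Summit.ResolutionOfSingularities.ResolutionOfSingularities.Theorems.WildQuotientResolution.S1.BlowupCharts
open Summit.ResolutionOfSingularities.ResolutionOfSingularities.Theorems.WildQuotientResolution.S1.KillCert
open Summit.ResolutionOfSingularities.ResolutionOfSingularities.Theorems.WildQuotientResolution.S1.FreeModel
open Summit.ResolutionOfSingularities.ResolutionOfSingularities.Theorems.WildQuotientResolution.S1.GameFrame.GModel

namespace Summit.ResolutionOfSingularities.ResolutionOfSingularities.Theorems.WildQuotientResolution.S1.KillCert.QhSym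

variable {k : Type} [Field k] (σ : (MvPolynomial (Fin 4) k) ≃+* (MvPolynomial (Fin 4) k)) (hC : ∀ a : k, σ (C a) = C a)
  (h0 : σ (X 0) = X 0) (h1 : σ (X 1) = X 1 + X 0) (h2 : σ (X 2) = X 2 + X 0) (h3 : σ (X 3) = X 3 + (X 2 ^ 2 - X 1 ^ 3))
  (hh : (MvPolynomial (Fin 4) k)) (hσh : σ hh = hh)
  {p : ℕ} (hp : 0 < p) (hσpL : ∀ y : (Localization.Away hh), (⇑(sigmaAway σ hσh))^[p] y = y)
  (hσJ : ∀ n : ℕ, ((weightedFiltration (fun i => algebraMap (MvPolynomial (Fin 4) k) (Localization.Away hh) (X ((![0, 1, 2] : Fin 3 → Fin 4) i))) (![9, 2, 3] : Fin 3 → ℕ)).ideal n).map ((sigmaAway σ hσh) : (Localization.Away hh) →+* (Localization.Away hh)) ≤ (weightedFiltration (fun i => algebraMap (MvPolynomial (Fin 4) k) (Localization.Away hh) (X ((![0, 1, 2] : Fin 3 → Fin 4) i))) (![9, 2, 3] : Fin 3 → ℕ)).ideal n)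
  (ht : algebraMap (MvPolynomial (Fin 4) k) (Localization.Away hh) (X 2 ^ 2 - X 1 ^ 3) ∈ (weightedFiltration (fun i => algebraMap (MvPolynomial (Fin 4) k) (Localization.Away hh) (X ((![0, 1, 2] : Fin 3 → Fin 4) i))) (![9, 2, 3] : Fin 3 → ℕ)).ideal 6)
  {mg : ℕ} (mo : Fin mg → ℕ) (𝒜 : (Π j : Fin mg, ZMod (mo j)) → AddSubgroup (Localization.Away hh)) [GradedRing 𝒜]
  (hf : ∀ i, (fun i => algebraMap (MvPolynomial (Fin 4) k) (Localization.Away hh) (X ((![0, 1, 2] : Fin 3 → Fin 4) i))) i ∈ 𝒜 ((fun _ => (0 : Π j : Fin mg, ZMod (mo j))) i))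
  {dbar : ℕ} (y : ↥(𝒜 0)) (hy : y ∈ (traceFiltration 𝒜 (fun i => algebraMap (MvPolynomial (Fin 4) k) (Localization.Away hh) (X ((![0, 1, 2] : Fin 3 → Fin 4) i))) (![9, 2, 3] : Fin 3 → ℕ)).ideal dbar) (hσy : (sigmaAway σ hσh) (y : (Localization.Away hh)) = y)

set_option maxHeartbeats 4000000 in
set_option synthInstance.maxHeartbeats 400000 in
include hC h0 h1 h2 h3 hσy in
/-- ★★ **COVER obligation (C1) at `O`: the residual points of the producer chart `[N(x₁)]` over `W_O` lie in the member open `U_O = D(b_O)`.**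
On a producer chart `W` (affine open of a scheme `V`, `E : Γ(V, W) ≃ (R_c)₀` the pinned chart iso of the move atlas, cover element `c ↦ N(x₁′)^{n₁}`,
`n₁ > 0`) let `b ∈ Γ(V, W)` have chart value `E b = ((N_R(u₂′)·N_R(ĥ))^{dbar})/1 · (1/c)^{3p+3p}` (as exported by ✓`exists_cuspO_memberChart_rel_xi`).
If `v ∈ W` lies off `D(z₀)` and off `D(z₁)` for the residual sections `E z₀ = u₀′^{n₀}/c`, `E z₁ = t̂ⁿ/c` (`n₀, n > 0`), then `v ∈ D(b)`.
[OURS · L1 W4.5c · R4c `cusp_killsIn_two` COVER (C1) at `O`] -/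
theorem cuspO_mem_basicOpen_of_residual [NeZero p] (hk3 : (3 : k) ≠ 0) (a : k) (ha9 : a * 9 = 4)
    (hhh : hh = ∏ l : ZMod p, (X 1 + C (-a) + (l.val : (MvPolynomial (Fin 4) k)) * X 0))
    {n₁ : ℕ} (hn₁ : 0 < n₁)
    (hc1 : (coverElement 𝒜 (fun i => algebraMap (MvPolynomial (Fin 4) k) (Localization.Away hh) (X ((![0, 1, 2] : Fin 3 → Fin 4) i))) (![9, 2, 3] : Fin 3 → ℕ) dbar y hy) = (∏ l : ZMod p, ((cobordantAlgebra.u' (fun i => algebraMap (MvPolynomial (Fin 4) k) (Localization.Away hh) (X ((![0, 1, 2] : Fin 3 → Fin 4) i))) (![9, 2, 3] : Fin 3 → ℕ) 1) + algebraMap (Localization.Away hh) ↥(cobordantAlgebra (fun i => algebraMap (MvPolynomial (Fin 4) k) (Localization.Away hh) (X ((![0, 1, 2] : Fin 3 → Fin 4) i))) (![9, 2, 3] : Fin 3 → ℕ)) (l.val : (Localization.Away hh)) * ((cobordantAlgebra.u' (fun i => algebraMap (MvPolynomial (Fin 4) k) (Localization.Away hh) (X ((![0, 1, 2] : Fin 3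 → Fin 4) i))) (![9, 2, 3] : Fin 3 → ℕ) 0) * (cobordantAlgebra.s (fun i => algebraMap (MvPolynomial (Fin 4) k) (Localization.Away hh) (X ((![0, 1, 2] : Fin 3 → Fin 4) i))) (![9, 2, 3] : Fin 3 → ℕ)) ^ ((![9, 2, 3] : Fin 3 → ℕ) 0 - (![9, 2, 3] : Fin 3 → ℕ) 1)))) ^ n₁)
    {V : Scheme.{0}} {W : V.Opens} (hW : IsAffineOpen W)
    (E : letI := chartNodeGradedRing mo 𝒜 (fun i => algebraMap (MvPolynomial (Fin 4) k) (Localization.Away hh) (X ((![0, 1, 2] : Fin 3 → Fin 4) i))) (![9, 2, 3] : Fin 3 → ℕ) hf dbar y hy; Γ(V, W) ≃+* ↥((chartNodeGrading mo 𝒜 (fun i => algebraMap (MvPolynomial (Fin 4) k) (Localization.Away hh) (X ((![0, 1, 2] : Fin 3 → Fin 4) i))) (![9, 2, 3] : Fin 3 → ℕ) hf dbar y hy) 0))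
    (b : Γ(V, W))
    (hEb : letI := chartNodeGradedRing mo 𝒜 (fun i => algebraMap (MvPolynomial (Fin 4) k) (Localization.Away hh) (X ((![0, 1, 2] : Fin 3 → Fin 4) i))) (![9, 2, 3] : Fin 3 → ℕ) hf dbar y hy; ((E b : ↥((chartNodeGrading mo 𝒜 (fun i => algebraMap (MvPolynomial (Fin 4) k) (Localization.Away hh) (X ((![0, 1, 2] : Fin 3 → Fin 4) i))) (![9, 2, 3] : Fin 3 → ℕ) hf dbar y hy) 0)) : (ChartRing 𝒜 (fun i => algebraMap (MvPolynomial (Fin 4) k) (Localization.Away hh) (X ((![0, 1, 2] : Fin 3 → Fin 4) i))) (![9, 2, 3] : Fin 3 → ℕ) dbar y hy)) = (algebraMap ↥(cobordantAlgebra (fun i => algebraMap (MvPolynomial (Fin 4) k) (Localization.Away hh) (X ((![0, 1, 2] : Fin 3 → Fin 4) i))) (![9, 2, 3] : Fin 3 → ℕ)) (ChartRing 𝒜 (fun i => algebraMap (MvPolynomial (Fin 4) k) (Localization.Away hh) (X ((![0, 1, 2] : Fin 3 → Fin 4) i))) (![9, 2, 3] : Fin 3 → ℕ) dbar y hy)) (((∏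 j : ZMod p, (⇑(sigmaR (sigmaAway σ hσh) (fun i => algebraMap (MvPolynomial (Fin 4) k) (Localization.Away hh) (X ((![0, 1, 2] : Fin 3 → Fin 4) i))) (![9, 2, 3] : Fin 3 → ℕ) hσJ hp hσpL))^[j.val] (cobordantAlgebra.u' (fun i => algebraMap (MvPolynomial (Fin 4) k) (Localization.Away hh) (X ((![0, 1, 2] : Fin 3 → Fin 4) i))) (![9, 2, 3] : Fin 3 → ℕ) 2)) * ∏ j : ZMod p, (⇑(sigmaR (sigmaAway σ hσh) (fun i => algebraMap (MvPolynomial (Fin 4) k) (Localization.Away hh) (X ((![0, 1, 2] : Fin 3 → Fin 4) i))) (![9, 2, 3] : Fin 3 → ℕ) hσJ hp hσpL))^[j.val] (2 * (cobordantAlgebra.u' (fun i => algebraMap (MvPolynomial (Fin 4) k) (Localization.Away hh) (X ((![0, 1, 2] : Fin 3 → Fin 4) i))) (![9, 2, 3] : Fin 3 → ℕ) 2) - 3 * (cobordantAlgebra.s (fun i => algebraMap (MvPolynomial (Fin 4) k) (Localization.Away hh) (X ((![0, 1, 2] : Fin 3 → Fin 4) i))) (![9, 2, 3] : Fin 3 →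 ℕ)) * (cobordantAlgebra.u' (fun i => algebraMap (MvPolynomial (Fin 4) k) (Localization.Away hh) (X ((![0, 1, 2] : Fin 3 → Fin 4) i))) (![9, 2, 3] : Fin 3 → ℕ) 1) ^ 2)) ^ dbar) * IsLocalization.Away.invSelf (coverElement 𝒜 (fun i => algebraMap (MvPolynomial (Fin 4) k) (Localization.Away hh) (X ((![0, 1, 2] : Fin 3 → Fin 4) i))) (![9, 2, 3] : Fin 3 → ℕ) dbar y hy) ^ (3 * p + 3 * p))
    {n₀ n : ℕ} (hn₀ : 0 < n₀) (hn : 0 < n)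
    (hZ0 : letI := chartNodeGradedRing mo 𝒜 (fun i => algebraMap (MvPolynomial (Fin 4) k) (Localization.Away hh) (X ((![0, 1, 2] : Fin 3 → Fin 4) i))) (![9, 2, 3] : Fin 3 → ℕ) hf dbar y hy; (algebraMap ↥(cobordantAlgebra (fun i => algebraMap (MvPolynomial (Fin 4) k) (Localization.Away hh) (X ((![0, 1, 2] : Fin 3 → Fin 4) i))) (![9, 2, 3] : Fin 3 → ℕ)) (ChartRing 𝒜 (fun i => algebraMap (MvPolynomial (Fin 4) k) (Localization.Away hh) (X ((![0, 1, 2] : Fin 3 → Fin 4) i))) (![9, 2, 3] : Fin 3 → ℕ) dbar y hy)) ((cobordantAlgebra.u' (fun i => algebraMap (MvPolynomial (Fin 4) k) (Localization.Away hh) (X ((![0, 1, 2] : Fin 3 → Fin 4) i))) (![9, 2, 3] : Fin 3 → ℕ) 0) ^ n₀) * IsLocalization.Away.invSelf (coverElement 𝒜 (fun i => algebraMap (MvPolynomial (Fin 4) k) (Localization.Away hh) (X ((![0, 1, 2] : Fin 3 → Fin 4) i))) (![9, 2, 3] : Fin 3 → ℕ) dbar y hy) ∈ (chartNodeGrading mo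 𝒜 (fun i => algebraMap (MvPolynomial (Fin 4) k) (Localization.Away hh) (X ((![0, 1, 2] : Fin 3 → Fin 4) i))) (![9, 2, 3] : Fin 3 → ℕ) hf dbar y hy) 0)
    (hZ1 : letI := chartNodeGradedRing mo 𝒜 (fun i => algebraMap (MvPolynomial (Fin 4) k) (Localization.Away hh) (X ((![0, 1, 2] : Fin 3 → Fin 4) i))) (![9, 2, 3] : Fin 3 → ℕ) hf dbar y hy; (algebraMap ↥(cobordantAlgebra (fun i => algebraMap (MvPolynomial (Fin 4) k) (Localization.Away hh) (X ((![0, 1, 2] : Fin 3 → Fin 4) i))) (![9, 2, 3] : Fin 3 → ℕ)) (ChartRing 𝒜 (fun i => algebraMap (MvPolynomial (Fin 4) k) (Localization.Away hh) (X ((![0, 1, 2] : Fin 3 → Fin 4) i))) (![9, 2, 3] : Fin 3 → ℕ) dbar y hy)) (((⟨_, C_mul_T_mem_cobordantAlgebra _ _ ht⟩ : ↥(cobordantAlgebra (fun i => algebraMap (MvPolynomial (Fin 4) k) (Localization.Away hh) (X ((![0, 1, 2] : Fin 3 → Fin 4) i))) (![9, 2, 3] : Fin 3 → ℕ)))) ^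 n) * IsLocalization.Away.invSelf (coverElement 𝒜 (fun i => algebraMap (MvPolynomial (Fin 4) k) (Localization.Away hh) (X ((![0, 1, 2] : Fin 3 → Fin 4) i))) (![9, 2, 3] : Fin 3 → ℕ) dbar y hy) ∈ (chartNodeGrading mo 𝒜 (fun i => algebraMap (MvPolynomial (Fin 4) k) (Localization.Away hh) (X ((![0, 1, 2] : Fin 3 → Fin 4) i))) (![9, 2, 3] : Fin 3 → ℕ) hf dbar y hy) 0)
    {v : V} (hv : v ∈ W)
    (hv0 : letI := chartNodeGradedRing mo 𝒜 (fun i => algebraMap (MvPolynomial (Fin 4) k) (Localization.Away hh) (X ((![0, 1, 2] : Fin 3 → Fin 4) i))) (![9, 2, 3] : Fin 3 → ℕ) hf dbar y hy; v ∉ V.basicOpen (E.symm ⟨_, hZ0⟩))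
    (hv1 : letI := chartNodeGradedRing mo 𝒜 (fun i => algebraMap (MvPolynomial (Fin 4) k) (Localization.Away hh) (X ((![0, 1, 2] : Fin 3 → Fin 4) i))) (![9, 2, 3] : Fin 3 → ℕ) hf dbar y hy; v ∉ V.basicOpen (E.symm ⟨_, hZ1⟩)) :
    v ∈ V.basicOpen b := by
  letI instN := chartNodeGradedRing mo 𝒜 (fun i => algebraMap (MvPolynomial (Fin 4) k) (Localization.Away hh) (X ((![0, 1, 2] : Fin 3 → Fin 4) i))) (![9, 2, 3] : Fin 3 → ℕ) hf dbar y hy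
  have he1 : (![9, 2, 3] : Fin 3 → ℕ) 0 - ((![9, 2, 3] : Fin 3 → ℕ) 1 + 6) = 1 := by decide
  have he7 : (![9, 2, 3] : Fin 3 → ℕ) 0 - (![9, 2, 3] : Fin 3 → ℕ) 1 = 7 := by decide
  -- ### the pinned free model of the producer chart ring
  have hvW : ∀ i : Fin 3, (![9, 2, 3, 0] : Fin 4 → ℕ) ((![0, 1, 2] : Fin 3 → Fin 4) i) = (![9, 2, 3] : Fin 3 → ℕ) i := fun i => by fin_cases i <;> rfl
  have hWv : ∀ l : Fin 4, (![9, 2, 3, 0] : Fin 4 → ℕ) l = 0 ∨ ∃ i : Fin 3, (![0, 1, 2] : Fin 3 → Fin 4) i = l := fun l => by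
    fin_cases l
    exacts [Or.inr ⟨0, rfl⟩, Or.inr ⟨1, rfl⟩, Or.inr ⟨2, rfl⟩, Or.inl rfl]
  have hz : ∀ Ψ : ↥(cobordantAlgebra (fun i => algebraMap (MvPolynomial (Fin 4) k) (Localization.Away hh) (X ((![0, 1, 2] : Fin 3 → Fin 4) i))) (![9, 2, 3] : Fin 3 → ℕ)) ≃+* Localization.Away (cobordantAlgebra.subst k (![9, 2, 3, 0] : Fin 4 → ℕ) hh),
      (∀ a : (MvPolynomial (Fin 4) k), Ψ (algebraMap (Localization.Away hh) ↥(cobordantAlgebra (fun i => algebraMap (MvPolynomial (Fin 4) k) (Localization.Away hh) (X ((![0, 1, 2] : Fin 3 → Fin 4) i))) (![9, 2, 3] : Fin 3 → ℕ)) (algebraMap (MvPolynomial (Fin 4) k) (Localization.Away hh) a)) = algebraMap (MvPolynomial (Option (Fin 4)) k) _ (cobordantAlgebra.subst k (![9, 2, 3, 0] : Fin 4 → ℕ) a)) →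
      Ψ (cobordantAlgebra.s (fun i => algebraMap (MvPolynomial (Fin 4) k) (Localization.Away hh) (X ((![0, 1, 2] : Fin 3 → Fin 4) i))) (![9, 2, 3] : Fin 3 → ℕ)) = algebraMap (MvPolynomial (Option (Fin 4)) k) _ (X none) →
      (∀ i, Ψ (cobordantAlgebra.u' (fun i => algebraMap (MvPolynomial (Fin 4) k) (Localization.Away hh) (X ((![0, 1, 2] : Fin 3 → Fin 4) i))) (![9, 2, 3] : Fin 3 → ℕ) i) = algebraMap (MvPolynomial (Option (Fin 4)) k) _ (X (some ((![0, 1, 2] : Fin 3 → Fin 4) i)))) →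
      Associated (algebraMap (MvPolynomial (Option (Fin 4)) k) (Localization.Away (cobordantAlgebra.subst k (![9, 2, 3, 0] : Fin 4 → ℕ) hh)) ((∏ l : ZMod p, (X (some 1) + (l.val : (MvPolynomial (Option (Fin 4)) k)) * (X none ^ 6 * (X (some 0) * X none ^ ((![9, 2, 3] : Fin 3 → ℕ) 0 - ((![9, 2, 3] : Fin 3 → ℕ) 1 + 6)))))) ^ n₁)) (Ψ (coverElement 𝒜 (fun i => algebraMap (MvPolynomial (Fin 4) k) (Localization.Away hh) (X ((![0, 1, 2] : Fin 3 → Fin 4) i))) (![9, 2, 3] : Fin 3 → ℕ) dbar y hy)) := by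
    intro Ψ hΨa hΨs hΨu
    have heq : Ψ (coverElement 𝒜 (fun i => algebraMap (MvPolynomial (Fin 4) k) (Localization.Away hh) (X ((![0, 1, 2] : Fin 3 → Fin 4) i))) (![9, 2, 3] : Fin 3 → ℕ) dbar y hy) = algebraMap (MvPolynomial (Option (Fin 4)) k) (Localization.Away (cobordantAlgebra.subst k (![9, 2, 3, 0] : Fin 4 → ℕ) hh)) ((∏ l : ZMod p, (X (some 1) + (l.val : (MvPolynomial (Option (Fin 4)) k)) * (X none ^ 6 * (X (some 0) * X none ^ ((![9, 2, 3] : Fin 3 → ℕ) 0 - ((![9, 2, 3] : Fin 3 → ℕ) 1 + 6)))))) ^ n₁) := by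
      rw [hc1, map_pow, map_prod, map_pow, map_prod]
      refine congrArg (· ^ n₁) (Finset.prod_congr rfl fun l _ => ?_)
      rw [map_add, map_mul, map_mul, map_pow, hΨu 1, hΨu 0, hΨs, map_natCast, map_add, map_mul, map_mul, map_mul, map_pow, map_pow, map_natCast, he1, he7]
      simp only [Matrix.cons_val_one, Matrix.cons_val_zero, map_natCast]
      ring
    rw [heq]
  obtain ⟨Φ, hΦa, hΦs, hΦu⟩ := FreeModel.exists_chartFreeModelEquiv k (![9, 2, 3, 0] : Fin 4 → ℕ) hh (![0, 1, 2] : Fin 3 → Fin 4) (![9, 2, 3] : Fin 3 → ℕ) hvW hWv (fun i => algebraMap (MvPolynomial (Fin 4) k) (Localization.Away hh) (X ((![0, 1, 2] : Fin 3 → Fin 4) i))) (fun _ => rfl) 𝒜 dbar y hy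
    ((∏ l : ZMod p, (X (some 1) + (l.val : (MvPolynomial (Option (Fin 4)) k)) * (X none ^ 6 * (X (some 0) * X none ^ ((![9, 2, 3] : Fin 3 → ℕ) 0 - ((![9, 2, 3] : Fin 3 → ℕ) 1 + 6)))))) ^ n₁) hz
  -- ### the units of the model
  have hUq := IsLocalization.Away.algebraMap_isUnit (S := Localization.Away (cobordantAlgebra.subst k (![9, 2, 3, 0] : Fin 4 → ℕ) hh * (∏ l : ZMod p, (X (some 1) + (l.val : (MvPolynomial (Option (Fin 4)) k)) * (X none ^ 6 * (X (some 0) * X none ^ ((![9, 2, 3] : Fin 3 → ℕ) 0 - ((![9, 2, 3] : Fin 3 → ℕ) 1 + 6)))))) ^ n₁)) (cobordantAlgebra.subst k (![9, 2, 3, 0] : Fin 4 → ℕ) hh * (∏ l : ZMod p, (X (some 1) + (l.val : (MvPolynomial (Option (Fin 4)) k)) * (X none ^ 6 * (X (some 0) * X none ^ ((![9, 2, 3] : Fin 3 → ℕ) 0 - ((![9, 2, 3] : Fin 3 → ℕ) 1 + 6)))))) ^ n₁)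
  rw [map_mul] at hUq
  have hUh := isUnit_of_mul_isUnit_left hUq
  have hUN' := isUnit_of_mul_isUnit_right hUq
  rw [map_pow, isUnit_pow_iff hn₁.ne', he1] at hUN'
  -- ### points as primes of the chart ring
  refine BlowupCharts.mem_basicOpen_of_forall_isPrime hW (chartNodeGrading mo 𝒜 (fun i => algebraMap (MvPolynomial (Fin 4) k) (Localization.Away hh) (X ((![0, 1, 2] : Fin 3 → Fin 4) i))) (![9, 2, 3] : Fin 3 → ℕ) hf dbar y hy) E hv (E.symm ⟨_, hZ0⟩) (E.symm ⟨_, hZ1⟩) b ?_ hv0 hv1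
  intro Q hQ hQ0 hQ1
  rw [RingEquiv.apply_symm_apply] at hQ0 hQ1
  haveI := hQ
  -- `q ≠ 0` since `R_c` has a prime
  have hq0 : cobordantAlgebra.subst k (![9, 2, 3, 0] : Fin 4 → ℕ) hh * (∏ l : ZMod p, (X (some 1) + (l.val : (MvPolynomial (Option (Fin 4)) k)) * (X none ^ 6 * (X (some 0) * X none ^ ((![9, 2, 3] : Fin 3 → ℕ) 0 - ((![9, 2, 3] : Fin 3 → ℕ) 1 + 6)))))) ^ n₁ ≠ 0 := by
    intro hq
    haveI : Subsingleton (Localization.Away (cobordantAlgebra.subst k (![9, 2, 3, 0] : Fin 4 → ℕ) hh * (∏ l : ZMod p, (X (some 1) + (l.val : (MvPolynomial (Option (Fin 4)) k)) * (X none ^ 6 * (X (some 0) * X none ^ ((![9, 2, 3] : Fin 3 → ℕ) 0 - ((![9, 2, 3] : Fin 3 → ℕ) 1 + 6)))))) ^ n₁)) :=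
      (IsLocalization.uniqueOfZeroMem (M := Submonoid.powers (cobordantAlgebra.subst k (![9, 2, 3, 0] : Fin 4 → ℕ) hh * (∏ l : ZMod p, (X (some 1) + (l.val : (MvPolynomial (Option (Fin 4)) k)) * (X none ^ 6 * (X (some 0) * X none ^ ((![9, 2, 3] : Fin 3 → ℕ) 0 - ((![9, 2, 3] : Fin 3 → ℕ) 1 + 6)))))) ^ n₁))
        (S := Localization.Away (cobordantAlgebra.subst k (![9, 2, 3, 0] : Fin 4 → ℕ) hh * (∏ l : ZMod p, (X (some 1) + (l.val : (MvPolynomial (Option (Fin 4)) k)) * (X none ^ 6 * (X (some 0) * X none ^ ((![9, 2, 3] : Fin 3 → ℕ) 0 - ((![9, 2, 3] : Fin 3 → ℕ) 1 + 6)))))) ^ n₁)) (hq ▸ Submonoid.mem_powers _)).instSubsingleton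
    haveI : Subsingleton (ChartRing 𝒜 (fun i => algebraMap (MvPolynomial (Fin 4) k) (Localization.Away hh) (X ((![0, 1, 2] : Fin 3 → Fin 4) i))) (![9, 2, 3] : Fin 3 → ℕ) dbar y hy) := Φ.toEquiv.subsingleton
    exact hQ.ne_top (Q.eq_top_of_isUnit_mem (Q.zero_mem) (isUnit_of_subsingleton _))
  rw [hEb]
  exact cuspO_bHat_not_mem_of_residualSections σ hC h0 h1 h2 h3 hh hσh hp hσpL hσJ ht mo 𝒜 y hy hσy hq0 Φ hΦa hΦs hΦu hk3 a ha9 hhh hUh hUN' Q hn₀ hn hQ0 hQ1 dbar (3 * p + 3 * p)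

end Summit.ResolutionOfSingularities.ResolutionOfSingularities.Theorems.WildQuotientResolution.S1.KillCert.QhSym

end
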